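import Summits.Ventures.CertifiedManyBodySolver.Transport.LTIPrimalHubbardChainWindow
import Summits.Ventures.CertifiedManyBodySolver.Transport.LTIPrimalHubbardBridge
import HarnessLib

/-!
# Ventures/CertifiedManyBodySolver — Transport/LTIPrimalHubbardChainKSDN.lean

Speedrun cell sr-mbsolver — LIT team (lit-1 gen-5), D-16 r36 / D-18 r72(c).
HONEST FRAMING: first certified bounds; not a superconductivity verdict; every number certified or labelled float.

The by-value node of `Transport/LTIPrimalHubbardChain.lean` in the LITERAL form of the lane-B problem files (FORMAT-ltisdp §1,
model `hubbard_jw(U)`, §4.1): objective = the BOND energy of the first bond of the window with the repulsion on its LEFT site,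
`h = -t Σ_σ (c†_{1σ} c_{2σ} + c†_{2σ} c_{1σ}) + U n_{1↑} n_{1↓}` (here sites `1, 2` = `-1, 0 ∈ ℤ`), and density row = the TOTAL
density of the first site, `Re tr((n_{1↑} + n_{1↓}) ρ) = ν` (`ν = 2 nh / L`; half filling `ν = 1`; filling `p/q`: `ν = p/q`). The
other rows (positivity, trace, local translation invariance, `(N_↑, N_↓)`-sector zeros, real entries, entries `≤ 1`) are unchanged.

The reduction to the mean-energy form (`claim_meanEnergy_of_claim_ksdn`) is the window-level bridge of
`Transport/LTIPrimalHubbardBridge.lean` (the LTI row moves even observables by one site).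
[cite: KullEtAl2024, §II.B eq. (locTIn), §VI.B] [cite: Han2020Bootstrap, §2] [cite: ArakiMoriya2003, §4.1]
-/

noncomputable section

open Matrix Complex Filter Topology
open scoped ComplexOrder
open Literature.Probability.LatticeModels
open Literature.MathematicalPhysics.QuantumLattice
open Literature.MathematicalPhysics.QuantumLattice.HubbardWave0
open Literature.MathematicalPhysics.QuantumLattice.ThermodynamicLimit
open Literature.MathematicalPhysics.QuantumLattice.JordanWigner
open Literature.MathematicalPhysics.QuantumManyBody.StateRelaxation

namespace Summit.Ventures.CertifiedManyBodySolver.Transport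

/-! ### The node in FORMAT-ltisdp form: bond objective, total density of the first site -/

section KSDN

variable {Λ₀ Λ' : Finset (Site 1)}

/-- **FORMAT-ltisdp form ⇒ mean-energy form of the by-value node.** If `E ≤ Re tr(h ρ)` for every window state satisfying the
rows with the TOTAL density of site `-1` fixed to `ν'` and the BOND objective `h = toSpin(U n_{-1,↑}n_{-1,↓} − t B(-1,0))`, then
`E ≤ Re tr(toSpin(Γ(incl) E_Φ) ρ)` for every window state satisfying the rows with the per-spin densities of site `0` fixed to
`ν`, `ν' = 2ν` (the LTI row moves even observables by one site: `trace_meanEnergy_eq_bond_of_lti`).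
[cite: KullEtAl2024, §II.B eq. (locTIn)] -/
theorem claim_meanEnergy_of_claim_ksdn (t U : ℝ) (h₀ : Λ₀ ⊆ Λ') (hsh : affShiftSet 1 (unitVec 0) Λ₀ ⊆ Λ')
    (h0 : thicken ({0} : Finset (Site 1)) 1 ⊆ Λ') (hm0 : (-unitVec 0 : Site 1) ∈ Λ₀) (hz0 : (0 : Site 1) ∈ Λ₀)
    (hlow : IsLowerSet (Set.range (PolySite.incl h₀)))
    (hmono : StrictMono ((PolySite.affEmb 1 (unitVec 0) Λ₀).trans (PolySite.incl hsh)))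
    (hconv : (Set.range ((PolySite.affEmb 1 (unitVec 0) Λ₀).trans (PolySite.incl hsh))).OrdConnected)
    {ν ν' E : ℝ} (hνν : ν' = 2 * ν)
    (hclaim : ∀ ρ : Op (PolySite Λ') 4, ρ.PosSemidef → ρ.trace = 1 →
      spinPartialTrace ((PolySite.affEmb 1 (unitVec 0) Λ₀).trans (PolySite.incl hsh)) ρ =
        spinPartialTrace (PolySite.incl h₀) ρ →
      (∀ σ : Fin 2, ∀ k k' : TensorIndex (PolySite Λ') 4,
        (∑ x, if σ ∈ siteOcc (k x) then 1 else 0 : ℕ) ≠ (∑ x, if σ ∈ siteOcc (k' x) then 1 else 0 : ℕ) → ρ k k' = 0) →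
      ((toSpin (nAt (-unitVec 0) (h₀ hm0) 0 + nAt (-unitVec 0) (h₀ hm0) 1) * ρ).trace).re = ν' →
      (∀ k k' : TensorIndex (PolySite Λ') 4, starRingEnd ℂ (ρ k k') = ρ k k') →
      (∀ k k' : TensorIndex (PolySite Λ') 4, ‖ρ k k'‖ ≤ 1) →
      E ≤ ((toSpin ((U : ℂ) • (nAt (-unitVec 0) (h₀ hm0) 0 * nAt (-unitVec 0) (h₀ hm0) 1) +
          (-(t : ℂ)) • ∑ σ : Fin 2, ((cAt (-unitVec 0) (h₀ hm0) σ)ᴴ * cAt 0 (h₀ hz0) σ +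
            (cAt 0 (h₀ hz0) σ)ᴴ * cAt (-unitVec 0) (h₀ hm0) σ)) * ρ).trace).re) :
    ∀ ρ : Op (PolySite Λ') 4, ρ.PosSemidef → ρ.trace = 1 →
      spinPartialTrace ((PolySite.affEmb 1 (unitVec 0) Λ₀).trans (PolySite.incl hsh)) ρ =
        spinPartialTrace (PolySite.incl h₀) ρ →
      (∀ σ : Fin 2, ∀ k k' : TensorIndex (PolySite Λ') 4,
        (∑ x, if σ ∈ siteOcc (k x) then 1 else 0 : ℕ) ≠ (∑ x, if σ ∈ siteOcc (k' x) then 1 else 0 : ℕ) → ρ k k' = 0) →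
      (∀ σ : Fin 2, ((toSpin (nAt 0 (h₀ hz0) σ) * ρ).trace).re = ν) →
      (∀ k k' : TensorIndex (PolySite Λ') 4, starRingEnd ℂ (ρ k k') = ρ k k') →
      (∀ k k' : TensorIndex (PolySite Λ') 4, ‖ρ k k'‖ ≤ 1) →
      E ≤ ((toSpin (fermionEmbed (PolySite.incl h0) ((hubbardFermionInteraction 1 t U).meanEnergyObs 1)) * ρ).trace).re := by
  intro ρ hpsd htr hLTI hsec hdens hreal hbd
  obtain ⟨hobj, hn0⟩ := trace_meanEnergy_eq_bond_of_lti t U h₀ hsh h0 hm0 hz0 hlow hmono hconv hLTI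
  rw [hobj]
  refine hclaim ρ hpsd htr hLTI hsec ?_ hreal hbd
  rw [map_add, Matrix.add_mul, trace_add, Complex.add_re, ← hn0 0, ← hn0 1, hdens 0, hdens 1, hνν]
  ring

/-- **THEOREM B0, fermion case, FORMAT-ltisdp form (ring).** As `lti_primal_chain_energyPerSite_ge` with the unit translation,
a left sub-window `Λ₀ ∋ -1, 0`, the density row `Re tr((n_{-1,↑} + n_{-1,↓}) ρ) = ν` (TOTAL density of the first site,
`ν = 2nh/L`) and the objective `Re tr(h ρ)`, `h = toSpin(U n_{-1,↑}n_{-1,↓} - t Σ_σ (c†_{-1,σ}c_{0σ} + c†_{0σ}c_{-1,σ}))` — the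
`hubbard_jw(U)` term of FORMAT-ltisdp §4.1 on the first bond (`U` on the LEFT site). Then `E ≤ E₀(ring L, N = 2nh)/L`.
[cite: KullEtAl2024, §II.B, §VI.B] [cite: Han2020Bootstrap, §2] -/
theorem lti_primal_chain_energyPerSite_ge_ksdn {L : ℕ} [NeZero L] (t U : ℝ) (hL : 3 ≤ L) {nh : ℕ} (hn : nh ≤ L)
    (h₀ : Λ₀ ⊆ Λ') (hsh : affShiftSet 1 (unitVec 0) Λ₀ ⊆ Λ')
    (h0 : thicken ({0} : Finset (Site 1)) 1 ⊆ Λ') (hm0 : (-unitVec 0 : Site 1) ∈ Λ₀) (hz0 : (0 : Site 1) ∈ Λ₀)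
    (hInj : Set.InjOn (Torus.proj (d := 1) L) ↑Λ')
    (hlow : IsLowerSet (Set.range (PolySite.incl h₀)))
    (hmono : StrictMono ((PolySite.affEmb 1 (unitVec 0) Λ₀).trans (PolySite.incl hsh)))
    (hconv : (Set.range ((PolySite.affEmb 1 (unitVec 0) Λ₀).trans (PolySite.incl hsh))).OrdConnected)
    {ν E : ℝ} (hν : ν = 2 * (nh : ℝ) / (L : ℝ))
    (hclaim : ∀ ρ : Op (PolySite Λ') 4, ρ.PosSemidef → ρ.trace = 1 →
      spinPartialTrace ((PolySite.affEmb 1 (unitVec 0) Λ₀).trans (PolySite.incl hsh)) ρ =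
        spinPartialTrace (PolySite.incl h₀) ρ →
      (∀ σ : Fin 2, ∀ k k' : TensorIndex (PolySite Λ') 4,
        (∑ x, if σ ∈ siteOcc (k x) then 1 else 0 : ℕ) ≠ (∑ x, if σ ∈ siteOcc (k' x) then 1 else 0 : ℕ) → ρ k k' = 0) →
      ((toSpin (nAt (-unitVec 0) (h₀ hm0) 0 + nAt (-unitVec 0) (h₀ hm0) 1) * ρ).trace).re = ν →
      (∀ k k' : TensorIndex (PolySite Λ') 4, starRingEnd ℂ (ρ k k') = ρ k k') →
      (∀ k k' : TensorIndex (PolySite Λ') 4, ‖ρ k k'‖ ≤ 1) →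
      E ≤ ((toSpin ((U : ℂ) • (nAt (-unitVec 0) (h₀ hm0) 0 * nAt (-unitVec 0) (h₀ hm0) 1) +
          (-(t : ℂ)) • ∑ σ : Fin 2, ((cAt (-unitVec 0) (h₀ hm0) σ)ᴴ * cAt 0 (h₀ hz0) σ +
            (cAt 0 (h₀ hz0) σ)ᴴ * cAt (-unitVec 0) (h₀ hm0) σ)) * ρ).trace).re) :
    E ≤ energyPerSite (hubbardChain L) t U (2 * nh) :=
  lti_primal_chain_energyPerSite_ge t U hL hn h₀ (unitVec 0) hsh h0 (h₀ hz0) hInj hlow hmono hconv (ν := (nh : ℝ) / (L : ℝ))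
    rfl (claim_meanEnergy_of_claim_ksdn t U h₀ hsh h0 hm0 hz0 hlow hmono hconv (by rw [hν]; ring) hclaim)

/-- **THEOREM B0, fermion case, FORMAT-ltisdp form (thermodynamic limit, half filling, `ν = 1`).**
[cite: KullEtAl2024, §II.B, §VI.B] [cite: Han2020Bootstrap, §2] [cite: Ruelle1969, §2.2] -/
theorem lti_primal_chainEnergyDensity_ge_ksdn (t : ℝ) {U : ℝ} (hU : 0 ≤ U)
    (h₀ : Λ₀ ⊆ Λ') (hsh : affShiftSet 1 (unitVec 0) Λ₀ ⊆ Λ')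
    (h0 : thicken ({0} : Finset (Site 1)) 1 ⊆ Λ') (hm0 : (-unitVec 0 : Site 1) ∈ Λ₀) (hz0 : (0 : Site 1) ∈ Λ₀)
    (hlow : IsLowerSet (Set.range (PolySite.incl h₀)))
    (hmono : StrictMono ((PolySite.affEmb 1 (unitVec 0) Λ₀).trans (PolySite.incl hsh)))
    (hconv : (Set.range ((PolySite.affEmb 1 (unitVec 0) Λ₀).trans (PolySite.incl hsh))).OrdConnected)
    {E : ℝ}
    (hclaim : ∀ ρ : Op (PolySite Λ') 4, ρ.PosSemidef → ρ.trace = 1 →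
      spinPartialTrace ((PolySite.affEmb 1 (unitVec 0) Λ₀).trans (PolySite.incl hsh)) ρ =
        spinPartialTrace (PolySite.incl h₀) ρ →
      (∀ σ : Fin 2, ∀ k k' : TensorIndex (PolySite Λ') 4,
        (∑ x, if σ ∈ siteOcc (k x) then 1 else 0 : ℕ) ≠ (∑ x, if σ ∈ siteOcc (k' x) then 1 else 0 : ℕ) → ρ k k' = 0) →
      ((toSpin (nAt (-unitVec 0) (h₀ hm0) 0 + nAt (-unitVec 0) (h₀ hm0) 1) * ρ).trace).re = 1 →
      (∀ k k' : TensorIndex (PolySite Λ') 4, starRingEnd ℂ (ρ k k') = ρ k k') →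
      (∀ k k' : TensorIndex (PolySite Λ') 4, ‖ρ k k'‖ ≤ 1) →
      E ≤ ((toSpin ((U : ℂ) • (nAt (-unitVec 0) (h₀ hm0) 0 * nAt (-unitVec 0) (h₀ hm0) 1) +
          (-(t : ℂ)) • ∑ σ : Fin 2, ((cAt (-unitVec 0) (h₀ hm0) σ)ᴴ * cAt 0 (h₀ hz0) σ +
            (cAt 0 (h₀ hz0) σ)ᴴ * cAt (-unitVec 0) (h₀ hm0) σ)) * ρ).trace).re) :
    E ≤ hubbardChainEnergyDensity t U :=
  lti_primal_chainEnergyDensity_ge t hU h₀ (unitVec 0) hsh h0 (h₀ hz0) hlow hmono hconv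
    (claim_meanEnergy_of_claim_ksdn t U h₀ hsh h0 hm0 hz0 hlow hmono hconv (by norm_num) hclaim)

/-- **THEOREM B0, fermion case, FORMAT-ltisdp form (thermodynamic limit, filling `p/q`, total density `ν = p/q`).**
[cite: KullEtAl2024, §II.B, §VI.B] [cite: Han2020Bootstrap, §2] [cite: Ruelle1969, §2.2] -/
theorem lti_primal_chainEnergyDensityAt_ge_ksdn (t : ℝ) {U : ℝ} (hU : 0 ≤ U) {p q : ℕ} (hq : 1 ≤ q) (hp : p ≤ 2 * q)
    (h₀ : Λ₀ ⊆ Λ') (hsh : affShiftSet 1 (unitVec 0) Λ₀ ⊆ Λ')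
    (h0 : thicken ({0} : Finset (Site 1)) 1 ⊆ Λ') (hm0 : (-unitVec 0 : Site 1) ∈ Λ₀) (hz0 : (0 : Site 1) ∈ Λ₀)
    (hlow : IsLowerSet (Set.range (PolySite.incl h₀)))
    (hmono : StrictMono ((PolySite.affEmb 1 (unitVec 0) Λ₀).trans (PolySite.incl hsh)))
    (hconv : (Set.range ((PolySite.affEmb 1 (unitVec 0) Λ₀).trans (PolySite.incl hsh))).OrdConnected)
    {E : ℝ}
    (hclaim : ∀ ρ : Op (PolySite Λ') 4, ρ.PosSemidef → ρ.trace = 1 →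
      spinPartialTrace ((PolySite.affEmb 1 (unitVec 0) Λ₀).trans (PolySite.incl hsh)) ρ =
        spinPartialTrace (PolySite.incl h₀) ρ →
      (∀ σ : Fin 2, ∀ k k' : TensorIndex (PolySite Λ') 4,
        (∑ x, if σ ∈ siteOcc (k x) then 1 else 0 : ℕ) ≠ (∑ x, if σ ∈ siteOcc (k' x) then 1 else 0 : ℕ) → ρ k k' = 0) →
      ((toSpin (nAt (-unitVec 0) (h₀ hm0) 0 + nAt (-unitVec 0) (h₀ hm0) 1) * ρ).trace).re = (p : ℝ) / (q : ℝ) →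
      (∀ k k' : TensorIndex (PolySite Λ') 4, starRingEnd ℂ (ρ k k') = ρ k k') →
      (∀ k k' : TensorIndex (PolySite Λ') 4, ‖ρ k k'‖ ≤ 1) →
      E ≤ ((toSpin ((U : ℂ) • (nAt (-unitVec 0) (h₀ hm0) 0 * nAt (-unitVec 0) (h₀ hm0) 1) +
          (-(t : ℂ)) • ∑ σ : Fin 2, ((cAt (-unitVec 0) (h₀ hm0) σ)ᴴ * cAt 0 (h₀ hz0) σ +
            (cAt 0 (h₀ hz0) σ)ᴴ * cAt (-unitVec 0) (h₀ hm0) σ)) * ρ).trace).re) :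
    E ≤ hubbardChainEnergyDensityAt t U p q := by
  have hq0 : (q : ℝ) ≠ 0 := Nat.cast_ne_zero.2 (by omega)
  exact lti_primal_chainEnergyDensityAt_ge t hU hq hp h₀ (unitVec 0) hsh h0 (h₀ hz0) hlow hmono hconv
    (claim_meanEnergy_of_claim_ksdn t U h₀ hsh h0 hm0 hz0 hlow hmono hconv (by field_simp) hclaim)

end KSDN

/-! ### The bond objective in the Jordan–Wigner product basis (the by-value link to the problem file's `h`) -/

section ProductBasis

/-- `-1 < 0` as sites of a window of `ℤ¹`, with no site in between. [folklore] -/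
theorem pt_neg_unitVec_covBy_zero {Λ' : Finset (Site 1)} (hm : (-unitVec 0 : Site 1) ∈ Λ') (hz : (0 : Site 1) ∈ Λ') :
    PolySite.pt (-unitVec 0) hm < PolySite.pt 0 hz ∧
      ∀ z : PolySite Λ', PolySite.pt (-unitVec 0) hm < z → ¬ z < PolySite.pt 0 hz := by
  refine ⟨?_, fun z h1 h2 => ?_⟩
  · rw [PolySite.lt_iff_apply, PolySite.ofLex_coe_pt, PolySite.ofLex_coe_pt]
    simp [unitVec]
  · rw [PolySite.lt_iff_apply, PolySite.ofLex_coe_pt] at h1 h2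
    simp only [Pi.neg_apply, unitVec, Pi.single_eq_same, Pi.zero_apply] at h1 h2
    omega

/-- **The FORMAT-ltisdp bond term in the product basis.** With `p = -1`, `p' = 0` (adjacent sites of the window):
`toSpin(U n_{p↑}n_{p↓} - t Σ_σ (c†_{pσ} c_{p'σ} + c†_{p'σ} c_{pσ}))
   = U (n_↑n_↓)_p - t Σ_σ [(c†_σ F)_p (c_σ)_{p'} + (F c_σ)_p (c†_σ)_{p'}]`
— one- and two-site product operators with THE MODEL's explicit `4 × 4` one-site matrices in the local basis `|0⟩,|↑⟩,|↓⟩,|↑↓⟩`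
(`siteDouble_eq`, `siteAnnihilation_zero_eq/_one_eq`, `siteParity_eq`, and below `siteCreation_zero/one_mul_siteParity`,
`siteParity_mul_siteAnnihilation_zero/one`, `siteCreation_zero/one_eq`; the Jordan–Wigner factor `F` sits on the LEFT site). This is
the statement to diff against the problem file's `h` (FORMAT-ltisdp §4.1: modes site-major, `s = n↑ + 2n↓`).
[cite: EsslerEtAl2005, §12.3.4 eqs. (12.196)–(12.201)] [cite: KullEtAl2024, §VI.B] -/
theorem toSpin_bond_eq_onSite {Λ' : Finset (Site 1)} (t U : ℝ) (hm : (-unitVec 0 : Site 1) ∈ Λ') (hz : (0 : Site 1) ∈ Λ') :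
    toSpin ((U : ℂ) • (nAt (-unitVec 0) hm 0 * nAt (-unitVec 0) hm 1) +
        (-(t : ℂ)) • ∑ σ : Fin 2, ((cAt (-unitVec 0) hm σ)ᴴ * cAt 0 hz σ + (cAt 0 hz σ)ᴴ * cAt (-unitVec 0) hm σ)) =
      (U : ℂ) • onSite (PolySite.pt (-unitVec 0) hm) siteDouble +
        (-(t : ℂ)) • ∑ σ : Fin 2,
          (onSite (PolySite.pt (-unitVec 0) hm) (siteCreation σ * siteParity) * onSite (PolySite.pt 0 hz) (siteAnnihilation σ) +
            onSite (PolySite.pt (-unitVec 0) hm) (siteParity * siteAnnihilation σ) * onSite (PolySite.pt 0 hz) (siteCreation σ)) := by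
  obtain ⟨hlt, hcov⟩ := pt_neg_unitVec_covBy_zero hm hz
  rw [map_add, map_smul, map_smul, map_sum, toSpin_numberOp_mul_numberOp]
  congr 2
  refine Finset.sum_congr rfl fun σ _ => ?_
  rw [map_add, cAt, cAt, annihilation_conjTranspose, annihilation_conjTranspose,
    toSpin_creation_mul_annihilation_of_covBy hlt hcov, toSpin_creation_mul_annihilation_of_covBy' hlt hcov]

end ProductBasis


/-! ### The explicit one-site factors of the bond term (for the entry-by-entry diff against the problem file's `h`) -/

section Factors

/-- `c†_↑ F = e_2^1 - e_4^3` (local basis `|0⟩,|↑⟩,|↓⟩,|↑↓⟩`). [cite: EsslerEtAl2005, §12.3.4 eqs. (12.198)–(12.200)] -/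
theorem siteCreation_zero_mul_siteParity :
    siteCreation 0 * siteParity = !![0, 0, 0, 0; 1, 0, 0, 0; 0, 0, 0, 0; 0, 0, -1, 0] := by
  rw [siteCreation, siteAnnihilation_zero_eq, siteParity_eq]
  ext a b
  fin_cases a <;> fin_cases b <;> simp [Matrix.mul_apply, Fin.sum_univ_four, Matrix.conjTranspose_apply]

/-- `c†_↓ F = e_3^1 + e_4^2`. [cite: EsslerEtAl2005, §12.3.4 eqs. (12.198)–(12.201)] -/
theorem siteCreation_one_mul_siteParity :
    siteCreation 1 * siteParity = !![0, 0, 0, 0; 0, 0, 0, 0; 1, 0, 0, 0; 0, 1, 0, 0] := by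
  rw [siteCreation, siteAnnihilation_one_eq, siteParity_eq]
  ext a b
  fin_cases a <;> fin_cases b <;> simp [Matrix.mul_apply, Fin.sum_univ_four, Matrix.conjTranspose_apply]

/-- `F c_↑ = e_1^2 - e_3^4`. [cite: EsslerEtAl2005, §12.3.4 eqs. (12.198)–(12.200)] -/
theorem siteParity_mul_siteAnnihilation_zero :
    siteParity * siteAnnihilation 0 = !![0, 1, 0, 0; 0, 0, 0, 0; 0, 0, 0, -1; 0, 0, 0, 0] := by
  rw [siteAnnihilation_zero_eq, siteParity_eq]
  ext a b
  fin_cases a <;> fin_cases b <;> simp [Matrix.mul_apply, Fin.sum_univ_four]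

/-- `F c_↓ = e_1^3 + e_2^4`. [cite: EsslerEtAl2005, §12.3.4 eqs. (12.198)–(12.201)] -/
theorem siteParity_mul_siteAnnihilation_one :
    siteParity * siteAnnihilation 1 = !![0, 0, 1, 0; 0, 0, 0, 1; 0, 0, 0, 0; 0, 0, 0, 0] := by
  rw [siteAnnihilation_one_eq, siteParity_eq]
  ext a b
  fin_cases a <;> fin_cases b <;> simp [Matrix.mul_apply, Fin.sum_univ_four]

/-- `c†_↑ = e_2^1 + e_4^3`. [cite: EsslerEtAl2005, §12.3.4 eq. (12.199)] -/
theorem siteCreation_zero_eq : siteCreation 0 = !![0, 0, 0, 0; 1, 0, 0, 0; 0, 0, 0, 0; 0, 0, 1, 0] := by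
  rw [siteCreation, siteAnnihilation_zero_eq]
  ext a b
  fin_cases a <;> fin_cases b <;> simp [Matrix.conjTranspose_apply]

/-- `c†_↓ = e_3^1 - e_4^2`. [cite: EsslerEtAl2005, §12.3.4 eq. (12.199)] -/
theorem siteCreation_one_eq : siteCreation 1 = !![0, 0, 0, 0; 0, 0, 0, 0; 1, 0, 0, 0; 0, -1, 0, 0] := by
  rw [siteCreation, siteAnnihilation_one_eq]
  ext a b
  fin_cases a <;> fin_cases b <;> simp [Matrix.conjTranspose_apply]

end Factors

/-! ### FORMAT-ltisdp form on the canonical window `{-1, 0, …, n+1}` -/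

section Canonical

/-- `-e₀ = -1 ∈ {-1, …, b}` for `b ≥ -1`. [folklore] -/
theorem neg_unitVec_mem_chainWindow {b : ℤ} (hb : -1 ≤ b) : (-unitVec 0 : Site 1) ∈ chainWindow (-1) b := by
  rw [mem_chainWindow]
  simp only [Pi.neg_apply, unitVec, Pi.single_eq_same]
  omega

/-- **THEOREM B0, fermion case, FORMAT-ltisdp form, canonical window, half filling.** Window `W = chainWindow (-1) (n+1)`
(`n + 3` sites `-1 < 0 < ⋯ < n+1`, the problem file's sites `1, …, n+3`), left sub-window `chainWindow (-1) n`, unit translation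
(row `Tr₁ρ = Tr_{n+3}ρ`), `(N_↑, N_↓)`-sector zeros, total density of the first site `= 1`, real entries bounded by one, bond
objective on the first bond with `U` on the left site: `E ≤ hubbardChainEnergyDensity t U` (`U ≥ 0`).
[cite: KullEtAl2024, §II.B, §VI.B] [cite: Han2020Bootstrap, §2] [cite: Ruelle1969, §2.2] -/
theorem lti_primal_chainWindow_energyDensity_ge_ksdn (t : ℝ) {U : ℝ} (hU : 0 ≤ U) (n : ℕ) {E : ℝ}
    (hclaim : ∀ ρ : Op (PolySite (chainWindow (-1) ((n : ℤ) + 1))) 4, ρ.PosSemidef → ρ.trace = 1 →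
      spinPartialTrace ((PolySite.affEmb 1 (unitVec 0) (chainWindow (-1) (n : ℤ))).trans
          (PolySite.incl (affShiftSet_chainWindow_subset (-1) (n : ℤ)))) ρ =
        spinPartialTrace (PolySite.incl (chainWindow_mono_right (-1) (by omega : (n : ℤ) ≤ n + 1))) ρ →
      (∀ σ : Fin 2, ∀ k k' : TensorIndex (PolySite (chainWindow (-1) ((n : ℤ) + 1))) 4,
        (∑ x, if σ ∈ siteOcc (k x) then 1 else 0 : ℕ) ≠ (∑ x, if σ ∈ siteOcc (k' x) then 1 else 0 : ℕ) → ρ k k' = 0) →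
      ((toSpin (nAt (-unitVec 0) (neg_unitVec_mem_chainWindow (by omega : (-1 : ℤ) ≤ n + 1)) 0 +
          nAt (-unitVec 0) (neg_unitVec_mem_chainWindow (by omega : (-1 : ℤ) ≤ n + 1)) 1) * ρ).trace).re = 1 →
      (∀ k k' : TensorIndex (PolySite (chainWindow (-1) ((n : ℤ) + 1))) 4, starRingEnd ℂ (ρ k k') = ρ k k') →
      (∀ k k' : TensorIndex (PolySite (chainWindow (-1) ((n : ℤ) + 1))) 4, ‖ρ k k'‖ ≤ 1) →
      E ≤ ((toSpin ((U : ℂ) • (nAt (-unitVec 0) (neg_unitVec_mem_chainWindow (by omega : (-1 : ℤ) ≤ n + 1)) 0 *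
            nAt (-unitVec 0) (neg_unitVec_mem_chainWindow (by omega : (-1 : ℤ) ≤ n + 1)) 1) +
          (-(t : ℂ)) • ∑ σ : Fin 2,
            ((cAt (-unitVec 0) (neg_unitVec_mem_chainWindow (by omega : (-1 : ℤ) ≤ n + 1)) σ)ᴴ *
                cAt 0 (zero_mem_chainWindow (by omega : (0 : ℤ) ≤ n + 1)) σ +
              (cAt 0 (zero_mem_chainWindow (by omega : (0 : ℤ) ≤ n + 1)) σ)ᴴ *
                cAt (-unitVec 0) (neg_unitVec_mem_chainWindow (by omega : (-1 : ℤ) ≤ n + 1)) σ)) * ρ).trace).re) :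
    E ≤ hubbardChainEnergyDensity t U :=
  lti_primal_chainEnergyDensity_ge_ksdn t hU _ _ (thicken_zero_one_subset_chainWindow (by omega : (1 : ℤ) ≤ n + 1))
    (neg_unitVec_mem_chainWindow (by omega : (-1 : ℤ) ≤ n)) (zero_mem_chainWindow (by omega : (0 : ℤ) ≤ n))
    (isLowerSet_range_incl_chainWindow _) (strictMono_affEmb_trans_incl _) (ordConnected_range_affEmb_trans_incl (n : ℤ) _)
    hclaim

/-- **THEOREM B0, fermion case, FORMAT-ltisdp form, canonical window, filling `p/q`** (total density of the first site
`= p/q`, `1 ≤ q`, `p ≤ 2q`, `U ≥ 0`): `E ≤ hubbardChainEnergyDensityAt t U p q`.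
[cite: KullEtAl2024, §II.B, §VI.B] [cite: Han2020Bootstrap, §2] [cite: Ruelle1969, §2.2] -/
theorem lti_primal_chainWindow_energyDensityAt_ge_ksdn (t : ℝ) {U : ℝ} (hU : 0 ≤ U) {p q : ℕ} (hq : 1 ≤ q)
    (hp : p ≤ 2 * q) (n : ℕ) {E : ℝ}
    (hclaim : ∀ ρ : Op (PolySite (chainWindow (-1) ((n : ℤ) + 1))) 4, ρ.PosSemidef → ρ.trace = 1 →
      spinPartialTrace ((PolySite.affEmb 1 (unitVec 0) (chainWindow (-1) (n : ℤ))).trans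
          (PolySite.incl (affShiftSet_chainWindow_subset (-1) (n : ℤ)))) ρ =
        spinPartialTrace (PolySite.incl (chainWindow_mono_right (-1) (by omega : (n : ℤ) ≤ n + 1))) ρ →
      (∀ σ : Fin 2, ∀ k k' : TensorIndex (PolySite (chainWindow (-1) ((n : ℤ) + 1))) 4,
        (∑ x, if σ ∈ siteOcc (k x) then 1 else 0 : ℕ) ≠ (∑ x, if σ ∈ siteOcc (k' x) then 1 else 0 : ℕ) → ρ k k' = 0) →
      ((toSpin (nAt (-unitVec 0) (neg_unitVec_mem_chainWindow (by omega : (-1 : ℤ) ≤ n + 1)) 0 +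
          nAt (-unitVec 0) (neg_unitVec_mem_chainWindow (by omega : (-1 : ℤ) ≤ n + 1)) 1) * ρ).trace).re =
        (p : ℝ) / (q : ℝ) →
      (∀ k k' : TensorIndex (PolySite (chainWindow (-1) ((n : ℤ) + 1))) 4, starRingEnd ℂ (ρ k k') = ρ k k') →
      (∀ k k' : TensorIndex (PolySite (chainWindow (-1) ((n : ℤ) + 1))) 4, ‖ρ k k'‖ ≤ 1) →
      E ≤ ((toSpin ((U : ℂ) • (nAt (-unitVec 0) (neg_unitVec_mem_chainWindow (by omega : (-1 : ℤ) ≤ n + 1)) 0 *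
            nAt (-unitVec 0) (neg_unitVec_mem_chainWindow (by omega : (-1 : ℤ) ≤ n + 1)) 1) +
          (-(t : ℂ)) • ∑ σ : Fin 2,
            ((cAt (-unitVec 0) (neg_unitVec_mem_chainWindow (by omega : (-1 : ℤ) ≤ n + 1)) σ)ᴴ *
                cAt 0 (zero_mem_chainWindow (by omega : (0 : ℤ) ≤ n + 1)) σ +
              (cAt 0 (zero_mem_chainWindow (by omega : (0 : ℤ) ≤ n + 1)) σ)ᴴ *
                cAt (-unitVec 0) (neg_unitVec_mem_chainWindow (by omega : (-1 : ℤ) ≤ n + 1)) σ)) * ρ).trace).re) :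
    E ≤ hubbardChainEnergyDensityAt t U p q :=
  lti_primal_chainEnergyDensityAt_ge_ksdn t hU hq hp _ _
    (thicken_zero_one_subset_chainWindow (by omega : (1 : ℤ) ≤ n + 1))
    (neg_unitVec_mem_chainWindow (by omega : (-1 : ℤ) ≤ n)) (zero_mem_chainWindow (by omega : (0 : ℤ) ≤ n))
    (isLowerSet_range_incl_chainWindow _) (strictMono_affEmb_trans_incl _) (ordConnected_range_affEmb_trans_incl (n : ℤ) _)
    hclaim

end Canonical

end Summit.Ventures.CertifiedManyBodySolver.Transport
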